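import Mathlib
import Literature.Analysis.FluidPDE.StretchedLayerNS
import Summits.AnomalousDissipation.AnomalousDissipation.Theorems.MarginalStabilityChainStretchedVortexRowsStubDissipationReadOutTools
import HarnessLib

/-!
# Dissipation read-out of a stretched vortex row: `layerDissipation = (ν/L) ∫∫_cell ω²`

Stub `stub_dissipationReadOut` of the line `braid-closed-large-circulation-gluing`
(crux `stmt-AnomalousDissipation-3009`, `MarginalStabilityChain.StretchedVortexRows`).

For `x`-periodic (period `L > 0`), divergence-free plane fields `u, v ∈ C²(ℝ²)` whose gradients
decay like `C'e^{-a|y|}` across the layer, the dissipation per unit area of the stretched-layer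
class (`Literature.Analysis.FluidPDE.layerDissipation ν L u v = (ν/L) ∫⁻_{x∈(0,L]} ∫⁻_y |∇(u,v)|²`,
an extended real) equals `ofReal ((ν/L) ∫_{x∈(0,L]} ∫_y ω²)`, `ω = ∂ₓv - ∂_yu` (Bochner integrals).

## Proof

Pointwise `|∇(u,v)|² = ω² + (∂ₓu + ∂_yv)² - 2J` with the Jacobian `J = ∂ₓu ∂_yv - ∂_yu ∂ₓv`, and
`∂ₓu + ∂_yv = 0`. All densities are continuous and `O(e^{-2a|y|})`, hence integrable on the strip
`(0, L] × ℝ` (`DissipationReadOut.integrable_strip`), so the iterated `lintegral` is the `ofReal`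
of the Bochner integral over the product measure (Tonelli `lintegral_prod`,
`ofReal_integral_eq_lintegral_ofReal`), which splits as `∫∫ω² - 2∫∫J` and is converted back to an
iterated integral by Fubini (`integral_prod`). The heart is `∫∫_strip J = 0`
(`DissipationReadOut.integral_jac_eq_zero`): since mixed partials of `v` commute,
`J = ∂ₓ(u ∂_yv) - ∂_y(u ∂ₓv)`; for every `y`, `∫₀ᴸ ∂ₓ(u ∂_yv) dx = 0` by periodicity (FTC), and
`∫₀ᴸ ∂_y(u ∂ₓv) dx = g'(y)` for `g(y) = ∫₀ᴸ u ∂ₓv dx` (differentiation under the integral sign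
on the compact period); `u` is bounded (`u(·,0)` is continuous periodic and
`|u(x,y) - u(x,0)| ≤ ∫ C'e^{-a|t|} dt`), so `|g(y)| ≤ L‖u‖_∞ C'e^{-a|y|} → 0` at `±∞`, while
`g' = -∫₀ᴸ J dx` is integrable (Fubini); the FTC on `ℝ` (`integral_of_hasDerivAt_of_tendsto`) gives
`∫ g' = 0`, i.e. `∫_y ∫₀ᴸ J = 0`.

The slice-derivative dictionary is the sibling file `…StubPressureReconstructionTools`
(`PressureTools.hasDerivAt_dX/dY`, `contDiff_dX/dY_of_le`, `dX_dY_comm`, `continuous_sliceX/Y`);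
strip integrability and the decay algebra are in `…StubDissipationReadOutTools`.
-/

-- summit and problem are both named `AnomalousDissipation`, so every name repeats the component
set_option linter.dupNamespace false

noncomputable section

open scoped BigOperators Topology RealInnerProductSpace ContDiff ENNReal
open Filter Set Function MeasureTheory WithLp

namespace Summit.AnomalousDissipation.AnomalousDissipation.Theorems
namespace MarginalStabilityChainStretchedVortexRows

namespace DissipationReadOut

open Literature.Analysis.FluidPDE Literature.Analysis.FluidPDE.StretchedLayer PressureTools

/-! ### The Jacobian integrates to zero over the period strip -/

variable {u v : ℝ → ℝ → ℝ} {L : ℝ}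

/-- `∫₀ᴸ ∂ₓ(u ∂_y v)(x, y) dx = 0` for `x`-periodic `C²` fields (FTC + periodicity). [folklore] -/
theorem intervalIntegral_P_eq_zero (hu : ContDiff ℝ 2 (fun q : ℝ × ℝ => u q.1 q.2))
    (hv : ContDiff ℝ 2 (fun q : ℝ × ℝ => v q.1 q.2))
    (hper : ∀ x y, u (x + L) y = u x y ∧ v (x + L) y = v x y) (y : ℝ) :
    ∫ x in (0 : ℝ)..L, (dX u x y * dY v x y + u x y * dX (dY v) x y) = 0 := by
  have hu1 : ContDiff ℝ 1 (fun q : ℝ × ℝ => u q.1 q.2) := hu.of_le one_le_two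
  have hv1 : ContDiff ℝ 1 (fun q : ℝ × ℝ => v q.1 q.2) := hv.of_le one_le_two
  have hv' : ContDiff ℝ 1 (fun q : ℝ × ℝ => dY v q.1 q.2) :=
    contDiff_dY_of_le (m := 1) hv (by norm_num)
  have hud : Differentiable ℝ (fun q : ℝ × ℝ => u q.1 q.2) := hu.differentiable (by simp)
  have hv'd : Differentiable ℝ (fun q : ℝ × ℝ => dY v q.1 q.2) := hv'.differentiable (by simp)
  have hderiv : ∀ x ∈ uIcc (0 : ℝ) L,
      HasDerivAt (fun s => u s y * dY v s y) (dX u x y * dY v x y + u x y * dX (dY v) x y) x :=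
    fun x _ => (hasDerivAt_dX (hud (x, y))).mul (hasDerivAt_dX (hv'd (x, y)))
  have hcont : Continuous fun x => dX u x y * dY v x y + u x y * dX (dY v) x y :=
    ((continuous_sliceX (continuous_dX hu1) y).mul (continuous_sliceX (continuous_dY hv1) y)).add
      ((continuous_sliceX hu.continuous y).mul (continuous_sliceX (continuous_dX hv') y))
  rw [intervalIntegral.integral_eq_sub_of_hasDerivAt hderiv (hcont.intervalIntegrable _ _)]
  have h1 : u L y = u 0 y := by simpa using (hper 0 y).1
  have h2 : dY v L y = dY v 0 y := by simpa using dY_periodic (fun a b => (hper a b).2) 0 y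
  rw [h1, h2, sub_self]

/-- Differentiation under the integral sign: `g(y) = ∫₀ᴸ u ∂ₓv dx` has derivative
`g'(y) = ∫₀ᴸ ∂_y(u ∂ₓv) dx = ∫₀ᴸ (∂_y u ∂ₓ v + u ∂_y∂ₓ v) dx` for `C²` fields (Mathlib
`intervalIntegral.hasDerivAt_integral_of_dominated_loc_of_deriv_le`, the derivative being bounded
on the compact `[0, L] × B̄(y₀, 1)`). [folklore] -/
theorem hasDerivAt_g (hu : ContDiff ℝ 2 (fun q : ℝ × ℝ => u q.1 q.2))
    (hv : ContDiff ℝ 2 (fun q : ℝ × ℝ => v q.1 q.2)) (L y₀ : ℝ) :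
    HasDerivAt (fun y => ∫ x in (0 : ℝ)..L, u x y * dX v x y)
      (∫ x in (0 : ℝ)..L, (dY u x y₀ * dX v x y₀ + u x y₀ * dY (dX v) x y₀)) y₀ := by
  have hu1 : ContDiff ℝ 1 (fun q : ℝ × ℝ => u q.1 q.2) := hu.of_le one_le_two
  have hv1 : ContDiff ℝ 1 (fun q : ℝ × ℝ => v q.1 q.2) := hv.of_le one_le_two
  have hv' : ContDiff ℝ 1 (fun q : ℝ × ℝ => dX v q.1 q.2) :=
    contDiff_dX_of_le (m := 1) hv (by norm_num)
  have hud : Differentiable ℝ (fun q : ℝ × ℝ => u q.1 q.2) := hu.differentiable (by simp)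
  have hv'd : Differentiable ℝ (fun q : ℝ × ℝ => dX v q.1 q.2) := hv'.differentiable (by simp)
  have hF' : Continuous fun q : ℝ × ℝ =>
      dY u q.1 q.2 * dX v q.1 q.2 + u q.1 q.2 * dY (dX v) q.1 q.2 :=
    ((continuous_dY hu1).mul (continuous_dX hv1)).add (hu.continuous.mul (continuous_dY hv'))
  obtain ⟨M, hM⟩ :=
    (isCompact_uIcc.prod (isCompact_closedBall y₀ (1 : ℝ))).exists_bound_of_continuousOn
      (s := uIcc (0 : ℝ) L ×ˢ Metric.closedBall y₀ 1) hF'.continuousOn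
  have hFy : ∀ y, Continuous fun x => u x y * dX v x y := fun y =>
    (continuous_sliceX hu.continuous y).mul (continuous_sliceX (continuous_dX hv1) y)
  have hF'y : Continuous fun x => dY u x y₀ * dX v x y₀ + u x y₀ * dY (dX v) x y₀ :=
    ((continuous_sliceX (continuous_dY hu1) y₀).mul
      (continuous_sliceX (continuous_dX hv1) y₀)).add
      ((continuous_sliceX hu.continuous y₀).mul (continuous_sliceX (continuous_dY hv') y₀))
  have key := intervalIntegral.hasDerivAt_integral_of_dominated_loc_of_deriv_le
    (F := fun y x => u x y * dX v x y)
    (F' := fun y x => dY u x y * dX v x y + u x y * dY (dX v) x y)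
    (x₀ := y₀) (s := Metric.ball y₀ 1) (bound := fun _ => M) (μ := volume) (a := 0) (b := L)
    (Metric.ball_mem_nhds y₀ one_pos)
    (Eventually.of_forall fun y => (hFy y).aestronglyMeasurable)
    ((hFy y₀).intervalIntegrable _ _)
    hF'y.aestronglyMeasurable
    (ae_of_all _ fun x hx y hy =>
      hM (x, y) ⟨uIoc_subset_uIcc hx, Metric.ball_subset_closedBall hy⟩)
    intervalIntegrable_const
    (ae_of_all _ fun x _ y _ => (hasDerivAt_dY (hud (x, y))).mul (hasDerivAt_dY (hv'd (x, y))))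
  exact key.2

/-- `∫₀ᴸ J(x, y) dx = -∫₀ᴸ ∂_y(u ∂ₓv)(x, y) dx`, where
`J = ∂ₓu ∂_yv - ∂_yu ∂ₓv = ∂ₓ(u ∂_yv) - ∂_y(u ∂ₓv)` (mixed partials of `v` commute). [folklore] -/
theorem intervalIntegral_J (hu : ContDiff ℝ 2 (fun q : ℝ × ℝ => u q.1 q.2))
    (hv : ContDiff ℝ 2 (fun q : ℝ × ℝ => v q.1 q.2))
    (hper : ∀ x y, u (x + L) y = u x y ∧ v (x + L) y = v x y) (y : ℝ) :
    ∫ x in (0 : ℝ)..L, (dX u x y * dY v x y - dY u x y * dX v x y) =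
      -∫ x in (0 : ℝ)..L, (dY u x y * dX v x y + u x y * dY (dX v) x y) := by
  have hu1 : ContDiff ℝ 1 (fun q : ℝ × ℝ => u q.1 q.2) := hu.of_le one_le_two
  have hv1 : ContDiff ℝ 1 (fun q : ℝ × ℝ => v q.1 q.2) := hv.of_le one_le_two
  have hvX : ContDiff ℝ 1 (fun q : ℝ × ℝ => dX v q.1 q.2) :=
    contDiff_dX_of_le (m := 1) hv (by norm_num)
  have hvY : ContDiff ℝ 1 (fun q : ℝ × ℝ => dY v q.1 q.2) :=
    contDiff_dY_of_le (m := 1) hv (by norm_num)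
  have hpt : ∀ x, dX u x y * dY v x y - dY u x y * dX v x y =
      (dX u x y * dY v x y + u x y * dX (dY v) x y) -
        (dY u x y * dX v x y + u x y * dY (dX v) x y) := by
    intro x
    rw [dX_dY_comm hv x y]
    ring
  simp_rw [hpt]
  have hP : Continuous fun x => dX u x y * dY v x y + u x y * dX (dY v) x y :=
    ((continuous_sliceX (continuous_dX hu1) y).mul (continuous_sliceX (continuous_dY hv1) y)).add
      ((continuous_sliceX hu.continuous y).mul (continuous_sliceX (continuous_dX hvY) y))
  have hQ : Continuous fun x => dY u x y * dX v x y + u x y * dY (dX v) x y :=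
    ((continuous_sliceX (continuous_dY hu1) y).mul (continuous_sliceX (continuous_dX hv1) y)).add
      ((continuous_sliceX hu.continuous y).mul (continuous_sliceX (continuous_dY hvX) y))
  rw [intervalIntegral.integral_sub (hP.intervalIntegrable _ _) (hQ.intervalIntegrable _ _),
    intervalIntegral_P_eq_zero hu hv hper y, zero_sub]

/-- A jointly `C¹`, `x`-periodic plane field with `∂_y u = O(e^{-a|y|})` is bounded: `u(·, 0)` is
continuous and periodic, and `|u(x, y) - u(x, 0)| ≤ ∫ C' e^{-a|t|} dt`. [folklore] -/
theorem exists_bound_u {C' a : ℝ} (hL : 0 < L) (hu : ContDiff ℝ 1 (fun q : ℝ × ℝ => u q.1 q.2))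
    (hper : ∀ x y, u (x + L) y = u x y) (ha : 0 < a)
    (hdec : ∀ x y, |dY u x y| ≤ C' * Real.exp (-a * |y|)) : ∃ B, ∀ x y, |u x y| ≤ B := by
  have hud : Differentiable ℝ (fun q : ℝ × ℝ => u q.1 q.2) := hu.differentiable (by simp)
  obtain ⟨M, hM⟩ : ∃ M, ∀ x ∈ Icc (0 : ℝ) L, |u x 0| ≤ M := by
    obtain ⟨M, hM⟩ := isCompact_Icc.exists_bound_of_continuousOn
      (s := Icc (0 : ℝ) L) (continuous_sliceX hu.continuous 0).continuousOn
    exact ⟨M, fun x hx => by simpa [Real.norm_eq_abs] using hM x hx⟩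
  have hM' : ∀ x, |u x 0| ≤ M := by
    intro x
    have hp : Function.Periodic (fun x => u x 0) L := fun x => hper x 0
    obtain ⟨x₀, hx₀, hx⟩ := hp.exists_mem_Ico₀ hL x
    rw [hx]
    exact hM x₀ (Ico_subset_Icc_self hx₀)
  refine ⟨M + ∫ t, C' * Real.exp (-a * |t|), fun x y => ?_⟩
  have henv : Integrable fun t => C' * Real.exp (-a * |t|) :=
    (integrable_exp_neg_mul_abs ha).const_mul C'
  have hint : Integrable (fun t => dY u x t) := by
    refine henv.mono' (continuous_sliceY (continuous_dY hu) x).aestronglyMeasurable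
      (ae_of_all _ fun t => ?_)
    rw [Real.norm_eq_abs]
    exact hdec x t
  have hftc : ∫ t in (0 : ℝ)..y, dY u x t = u x y - u x 0 :=
    intervalIntegral.integral_eq_sub_of_hasDerivAt (fun t _ => hasDerivAt_dY (hud (x, t)))
      hint.intervalIntegrable
  have hdiff : |u x y - u x 0| ≤ ∫ t, C' * Real.exp (-a * |t|) := by
    rw [← hftc]
    calc |∫ t in (0 : ℝ)..y, dY u x t| ≤ ∫ t in uIoc 0 y, |dY u x t| := by
          simpa only [← Real.norm_eq_abs] using
            (intervalIntegral.norm_integral_le_integral_norm_uIoc (f := fun t => dY u x t)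
              (a := 0) (b := y) (μ := volume))
      _ ≤ ∫ t, |dY u x t| := setIntegral_le_integral hint.abs (ae_of_all _ fun t => abs_nonneg _)
      _ ≤ ∫ t, C' * Real.exp (-a * |t|) := integral_mono hint.abs henv fun t => hdec x t
  calc |u x y| = |u x 0 + (u x y - u x 0)| := by ring_nf
    _ ≤ |u x 0| + |u x y - u x 0| := abs_add_le _ _
    _ ≤ M + ∫ t, C' * Real.exp (-a * |t|) := add_le_add (hM' x) hdiff

/-- `g(y) = ∫₀ᴸ u ∂ₓv dx → 0` as `y → ±∞` when `u` is bounded and `∂ₓ v = O(e^{-a|y|})`.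
[folklore] -/
theorem tendsto_g {B C' a : ℝ} (hB : ∀ x y, |u x y| ≤ B) (ha : 0 < a)
    (hdec : ∀ x y, |dX v x y| ≤ C' * Real.exp (-a * |y|)) :
    Tendsto (fun y => ∫ x in (0 : ℝ)..L, u x y * dX v x y) atTop (𝓝 0) ∧
      Tendsto (fun y => ∫ x in (0 : ℝ)..L, u x y * dX v x y) atBot (𝓝 0) := by
  have hbound : ∀ y, ‖∫ x in (0 : ℝ)..L, u x y * dX v x y‖ ≤
      B * (C' * Real.exp (-a * |y|)) * |L - 0| := by
    intro y
    refine intervalIntegral.norm_integral_le_of_norm_le_const fun x _ => ?_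
    rw [Real.norm_eq_abs, abs_mul]
    exact mul_le_mul (hB x y) (hdec x y) (abs_nonneg _) ((abs_nonneg _).trans (hB x y))
  have hlim : ∀ l : Filter ℝ, Tendsto (fun y => -a * |y|) l atBot →
      Tendsto (fun y => ∫ x in (0 : ℝ)..L, u x y * dX v x y) l (𝓝 0) := by
    intro l hl
    have h0 : Tendsto (fun y => B * (C' * Real.exp (-a * |y|)) * |L - 0|) l
        (𝓝 (B * (C' * 0) * |L - 0|)) :=
      (((Real.tendsto_exp_atBot.comp hl).const_mul C').const_mul B).mul_const _
    rw [mul_zero, mul_zero, zero_mul] at h0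
    exact squeeze_zero_norm hbound h0
  exact ⟨hlim _ (tendsto_abs_atTop_atTop.const_mul_atTop_of_neg (by linarith)),
    hlim _ (tendsto_abs_atBot_atTop.const_mul_atTop_of_neg (by linarith))⟩

/-- **The Jacobian `J = ∂ₓu ∂_yv - ∂_yu ∂ₓv` integrates to zero over the period strip**
`(0, L] × ℝ` for `x`-periodic `C²` fields with exponentially decaying gradients:
`∫₀ᴸ J dx = -g'(y)` with `g(y) = ∫₀ᴸ u ∂ₓv dx → 0` at `±∞`, so `∫∫ J = -∫ g' = 0` (FTC on `ℝ`,
Fubini). [folklore] -/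
theorem integral_jac_eq_zero (hL : 0 < L) (hu : ContDiff ℝ 2 (fun q : ℝ × ℝ => u q.1 q.2))
    (hv : ContDiff ℝ 2 (fun q : ℝ × ℝ => v q.1 q.2))
    (hper : ∀ x y, u (x + L) y = u x y ∧ v (x + L) y = v x y)
    (hdec : ∃ C' a : ℝ, 0 < a ∧ ∀ x y,
      |dX u x y| + |dY u x y| + |dX v x y| + |dY v x y| ≤ C' * Real.exp (-a * |y|)) :
    ∫ q, (dX u q.1 q.2 * dY v q.1 q.2 - dY u q.1 q.2 * dX v q.1 q.2)
      ∂((volume.restrict (Ioc 0 L)).prod volume) = 0 := by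
  obtain ⟨C', a, ha, hS⟩ := hdec
  have hu1 : ContDiff ℝ 1 (fun q : ℝ × ℝ => u q.1 q.2) := hu.of_le one_le_two
  have hv1 : ContDiff ℝ 1 (fun q : ℝ × ℝ => v q.1 q.2) := hv.of_le one_le_two
  have hdXv : ∀ x y, |dX v x y| ≤ C' * Real.exp (-a * |y|) := fun x y =>
    le_trans (by linarith [abs_nonneg (dX u x y), abs_nonneg (dY u x y), abs_nonneg (dY v x y)])
      (hS x y)
  have hdYu : ∀ x y, |dY u x y| ≤ C' * Real.exp (-a * |y|) := fun x y =>
    le_trans (by linarith [abs_nonneg (dX u x y), abs_nonneg (dX v x y), abs_nonneg (dY v x y)])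
      (hS x y)
  have hJint : Integrable
      (fun q : ℝ × ℝ => dX u q.1 q.2 * dY v q.1 q.2 - dY u q.1 q.2 * dX v q.1 q.2)
      ((volume.restrict (Ioc 0 L)).prod volume) := by
    refine integrable_strip (((continuous_dX hu1).mul (continuous_dY hv1)).sub
      ((continuous_dY hu1).mul (continuous_dX hv1))) (mul_pos two_pos ha) (C := C' ^ 2)
      (fun q => ?_) L
    show |dX u q.1 q.2 * dY v q.1 q.2 - dY u q.1 q.2 * dX v q.1 q.2| ≤ _
    rw [← sq_envelope]
    exact abs_jac_le (hS q.1 q.2)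
  rw [integral_prod_symm _ hJint]
  have hinner : ∀ y, ∫ x in Ioc 0 L, (dX u x y * dY v x y - dY u x y * dX v x y) =
      -∫ x in (0 : ℝ)..L, (dY u x y * dX v x y + u x y * dY (dX v) x y) := by
    intro y
    rw [← intervalIntegral.integral_of_le hL.le]
    exact intervalIntegral_J hu hv hper y
  simp only
  simp_rw [hinner]
  rw [MeasureTheory.integral_neg, neg_eq_zero]
  obtain ⟨B, hB⟩ := exists_bound_u hL hu1 (fun x y => (hper x y).1) ha hdYu
  have hg := tendsto_g (L := L) hB ha hdXv
  have hg'int : Integrable fun y =>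
      ∫ x in (0 : ℝ)..L, (dY u x y * dX v x y + u x y * dY (dX v) x y) := by
    have e : (fun y => ∫ x in (0 : ℝ)..L, (dY u x y * dX v x y + u x y * dY (dX v) x y)) =
        fun y => -∫ x in Ioc 0 L, (dX u x y * dY v x y - dY u x y * dX v x y) := by
      funext y
      rw [hinner, neg_neg]
    rw [e]
    exact hJint.integral_prod_right.neg
  have := integral_of_hasDerivAt_of_tendsto (fun y => hasDerivAt_g hu hv L y) hg'int hg.2 hg.1
  simpa using this

end DissipationReadOut

open DissipationReadOut PressureTools Literature.Analysis.FluidPDE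
  Literature.Analysis.FluidPDE.StretchedLayer

/-- **Dissipation read-out** (statement registered on stmt-AnomalousDissipation-3009 as
`stub_dissipationReadOut`): for `ν ≥ 0`, `L > 0` and `x`-periodic, divergence-free plane fields
`u, v ∈ C²(ℝ²)` with gradients bounded by `C'e^{-a|y|}` (`a > 0`),
`layerDissipation ν L u v = ofReal ((ν/L) ∫_{x∈(0,L]} ∫_y (∂ₓv - ∂_yu)²)`: pointwise
`|∇(u,v)|² = ω² + (div)² - 2J` with `J = ∂ₓu∂_yv - ∂_yu∂ₓv`, `div = 0`, and `∫∫_strip J = 0`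
(`DissipationReadOut.integral_jac_eq_zero`); the `lintegral`s of the nonnegative integrable
density are Bochner integrals (Tonelli/Fubini on `(0, L] × ℝ`). [folklore] -/
theorem stub_dissipationReadOut :
    ∀ (ν L : ℝ) (u v : ℝ → ℝ → ℝ), 0 ≤ ν → 0 < L →
      ContDiff ℝ 2 (fun q : ℝ × ℝ => u q.1 q.2) → ContDiff ℝ 2 (fun q : ℝ × ℝ => v q.1 q.2) →
      (∀ x y, u (x + L) y = u x y ∧ v (x + L) y = v x y) →
      (∀ x y, dX u x y + dY v x y = 0) →
      (∃ C' a : ℝ, 0 < a ∧ ∀ x y, |dX u x y| + |dY u x y| + |dX v x y| + |dY v x y| ≤ C' * Real.exp (-a * |y|)) →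
      layerDissipation ν L u v = ENNReal.ofReal (ν / L * ∫ x in Ioc 0 L, ∫ y, (dX v x y - dY u x y) ^ 2) := by
  intro ν L u v hν hL hu hv hper hdiv hdec
  have hJ := integral_jac_eq_zero hL hu hv hper hdec
  obtain ⟨C', a, ha, hS⟩ := hdec
  have hu1 : ContDiff ℝ 1 (fun q : ℝ × ℝ => u q.1 q.2) := hu.of_le one_le_two
  have hv1 : ContDiff ℝ 1 (fun q : ℝ × ℝ => v q.1 q.2) := hv.of_le one_le_two
  have hGc : Continuous fun q : ℝ × ℝ =>
      dX u q.1 q.2 ^ 2 + dY u q.1 q.2 ^ 2 + dX v q.1 q.2 ^ 2 + dY v q.1 q.2 ^ 2 :=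
    ((((continuous_dX hu1).pow 2).add ((continuous_dY hu1).pow 2)).add
      ((continuous_dX hv1).pow 2)).add ((continuous_dY hv1).pow 2)
  have hGint : Integrable (fun q : ℝ × ℝ =>
      dX u q.1 q.2 ^ 2 + dY u q.1 q.2 ^ 2 + dX v q.1 q.2 ^ 2 + dY v q.1 q.2 ^ 2)
      ((volume.restrict (Ioc 0 L)).prod volume) := by
    refine integrable_strip hGc (mul_pos two_pos ha) (C := C' ^ 2) (fun q => ?_) L
    show |dX u q.1 q.2 ^ 2 + dY u q.1 q.2 ^ 2 + dX v q.1 q.2 ^ 2 + dY v q.1 q.2 ^ 2| ≤ _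
    rw [← sq_envelope, abs_of_nonneg (by positivity)]
    exact grad_sq_le (hS q.1 q.2)
  have hWint : Integrable (fun q : ℝ × ℝ => (dX v q.1 q.2 - dY u q.1 q.2) ^ 2)
      ((volume.restrict (Ioc 0 L)).prod volume) := by
    refine integrable_strip (((continuous_dX hv1).sub (continuous_dY hu1)).pow 2)
      (mul_pos two_pos ha) (C := C' ^ 2) (fun q => ?_) L
    show |(dX v q.1 q.2 - dY u q.1 q.2) ^ 2| ≤ _
    rw [← sq_envelope, abs_of_nonneg (sq_nonneg _)]
    exact vort_sq_le (hS q.1 q.2)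
  have hJint : Integrable
      (fun q : ℝ × ℝ => dX u q.1 q.2 * dY v q.1 q.2 - dY u q.1 q.2 * dX v q.1 q.2)
      ((volume.restrict (Ioc 0 L)).prod volume) := by
    refine integrable_strip (((continuous_dX hu1).mul (continuous_dY hv1)).sub
      ((continuous_dY hu1).mul (continuous_dX hv1))) (mul_pos two_pos ha) (C := C' ^ 2)
      (fun q => ?_) L
    show |dX u q.1 q.2 * dY v q.1 q.2 - dY u q.1 q.2 * dX v q.1 q.2| ≤ _
    rw [← sq_envelope]
    exact abs_jac_le (hS q.1 q.2)
  rw [layerDissipation_def]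
  have hmeas : AEMeasurable (fun q : ℝ × ℝ => ENNReal.ofReal
      (dX u q.1 q.2 ^ 2 + dY u q.1 q.2 ^ 2 + dX v q.1 q.2 ^ 2 + dY v q.1 q.2 ^ 2))
      ((volume.restrict (Ioc 0 L)).prod volume) :=
    (ENNReal.measurable_ofReal.comp hGc.measurable).aemeasurable
  have step1 : ∫⁻ x in Ioc 0 L, ∫⁻ y, ENNReal.ofReal
      (dX u x y ^ 2 + dY u x y ^ 2 + dX v x y ^ 2 + dY v x y ^ 2) =
      ∫⁻ q, ENNReal.ofReal
        (dX u q.1 q.2 ^ 2 + dY u q.1 q.2 ^ 2 + dX v q.1 q.2 ^ 2 + dY v q.1 q.2 ^ 2)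
        ∂((volume.restrict (Ioc 0 L)).prod volume) :=
    (lintegral_prod _ hmeas).symm
  rw [step1, ← ofReal_integral_eq_lintegral_ofReal hGint (ae_of_all _ fun q => by positivity),
    ← ENNReal.ofReal_mul (div_nonneg hν hL.le)]
  congr 1
  congr 1
  have hpt : ∀ q : ℝ × ℝ,
      dX u q.1 q.2 ^ 2 + dY u q.1 q.2 ^ 2 + dX v q.1 q.2 ^ 2 + dY v q.1 q.2 ^ 2 =
      (dX v q.1 q.2 - dY u q.1 q.2) ^ 2 -
        2 * (dX u q.1 q.2 * dY v q.1 q.2 - dY u q.1 q.2 * dX v q.1 q.2) := fun q => by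
    linear_combination (dX u q.1 q.2 + dY v q.1 q.2) * hdiv q.1 q.2
  calc ∫ q, dX u q.1 q.2 ^ 2 + dY u q.1 q.2 ^ 2 + dX v q.1 q.2 ^ 2 + dY v q.1 q.2 ^ 2
        ∂((volume.restrict (Ioc 0 L)).prod volume)
      = ∫ q, ((dX v q.1 q.2 - dY u q.1 q.2) ^ 2 -
          2 * (dX u q.1 q.2 * dY v q.1 q.2 - dY u q.1 q.2 * dX v q.1 q.2))
          ∂((volume.restrict (Ioc 0 L)).prod volume) :=
        integral_congr_ae (Eventually.of_forall hpt)
    _ = (∫ q, (dX v q.1 q.2 - dY u q.1 q.2) ^ 2 ∂((volume.restrict (Ioc 0 L)).prod volume)) -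
          2 * ∫ q, (dX u q.1 q.2 * dY v q.1 q.2 - dY u q.1 q.2 * dX v q.1 q.2)
            ∂((volume.restrict (Ioc 0 L)).prod volume) := by
        rw [integral_sub hWint (hJint.const_mul 2), MeasureTheory.integral_const_mul]
    _ = ∫ q, (dX v q.1 q.2 - dY u q.1 q.2) ^ 2 ∂((volume.restrict (Ioc 0 L)).prod volume) := by
        rw [hJ, mul_zero, sub_zero]
    _ = ∫ x in Ioc 0 L, ∫ y, (dX v x y - dY u x y) ^ 2 := integral_prod _ hWint

end MarginalStabilityChainStretchedVortexRows
end Summit.AnomalousDissipation.AnomalousDissipation.Theorems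

end
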